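import Summits.AtomisticToContinuum.BoseEinsteinCondensation.Theses.BECFeynmanVortexArea
import Summits.AtomisticToContinuum.BoseEinsteinCondensation.Theorems.BECFeynmanVortexAreaMomentBoundCondensationCounting
import Summits.AtomisticToContinuum.BoseEinsteinCondensation.Theorems.BECGroundStateSOSPeriodicIRBoundWFAssembly
import Summits.AtomisticToContinuum.BoseEinsteinCondensation.Theorems.BECGroundStateSOSPeriodicIRBoundTransferArith
import HarnessLib

/-!
# Route BECFeynmanVortexArea, support item `MomentBoundCondensation` (stmt-AtomisticToContinuum-11846)

Closes `…Theses.BECFeynmanVortexArea.MomentBoundCondensation` (wanted verbatim also by route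
`BECNoCheapMomentum`, whose copy `…Theses.BECNoCheapMomentum.MomentBoundCondensation` is proved by the
same term, `momentBoundCondensation_proof'`): for an integrable repulsive finite-range `v`, the
fixed-`(N, L)` zero-momentum gap (`E₀^per(N,L) < E^per_N(q;L)` for `q ≠ 0`, body of
`ZeroMomentumGround`) and the quadratic particle–hole sector floor
(`2E₀(N) + 2κ‖k‖² ≤ E_{N+1}(k) + E_{N-1}(k)` on `‖k‖² ≤ Cρ`, body of `SectorGapFloor`) imply
constant-mode condensation `⟨Ψ, n₀Ψ⟩ ≥ N/2` of the `δ_N`-near-minimisers on the torus of side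
`L_N = (N/ρ)^{1/3}` at every small density.

Proof (the item's sketch, assembled from landed pieces):
* the analytic heart — the Wagner–Feynman two-sided moment bound for the zero-momentum part of
  near-minimisers, `γ_N(k)·θ ≤ 2(‖p‖² + N‖v‖₁/L³)` whenever the particle–hole sector sum at
  `p = 2πk/L` exceeds `2E₀` by `θ` — is the landed
  `Cruxes.PeriodicIRBound.LinearPhFloorWagner.WF.wagnerFeynmanWith_two`
  (file `BECGroundStateSOSPeriodicIRBoundWFAssembly.lean`); the hypotheses of the item are its inputs
  definitionally (`momentumSectorEnergy_eq_iInf` is `rfl`);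
* with the quadratic floor `θ = 2κ‖p‖²` on the window this gives the PER-MODE bound
  `γ_N(k) ≤ 1/κ + ρ‖v‖₁/(κ‖p‖²) ≤ 1/κ + ρ‖v‖₁L²/(4π²κ‖k‖_∞²)` (§1, `groundOccupation_le_of_floor`,
  `groundOccupation_le_on_window`);
* a least slack over the finite window turns the bounds on `γ_N(k) = ⨅_δ ⨆_{δ-near-min} n_k` into
  bounds on the occupations of all `δ`-near-minimisers (factor `2`;
  `exists_slack_of_groundOccupation_le` of the counting toolkit);
* mode counting as in `IRModeCounting_proof` (Parseval `∑_k n_k = N`, kinetic Markov bound for the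
  ultraviolet tail with the Dyson–LSSY upper bound `E₀^per ≤ AρN`), with the profile
  `B₁ + B₂/‖k‖_∞²` on the infrared window and the `d = 3` lattice sums `#{0 < ‖k‖_∞ ≤ M} ≤ 26M³`,
  `∑ ‖k‖_∞⁻² ≤ 26M` (`condensate_ge_half_of_sq` of the counting toolkit): the window carries
  `√ρN(52κ'³ + 13κ'‖v‖₁/π²)/κ ≤ N/4` particles for `ρ` small, the tail `≤ N/4`, hence `n₀ ≥ N/2`.
The hypothesis `∫v ≠ 0` of the item is not used.

References (shape of the argument only; nothing is cited as a fact): H. Wagner, Z. Physik 195 (1966)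
273; L. Pitaevskii, S. Stringari, J. Low Temp. Phys. 85 (1991) 377; S. Stringari, in *Bose–Einstein
Condensation* (CUP 1995) §2.2; LSSY2005 Thm. 2.2 and §1.2 (1.17)–(1.19).
-/

noncomputable section

open MeasureTheory Filter
open scoped ENNReal NNReal BigOperators

namespace Summit.AtomisticToContinuum.BoseEinsteinCondensation.Theorems.MomentBoundCondensation

open Literature.MathematicalPhysics.QuantumManyBody.BoseGas
open Summit.AtomisticToContinuum.BoseEinsteinCondensation.Theorems.PeriodicIRBound.Negative
  (groundOccupation)
open Summit.AtomisticToContinuum.BoseEinsteinCondensation.Theorems.GaussianDominationCan.Negative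
  (nsq nsq_nonneg one_le_norm_intVec)
open Summit.AtomisticToContinuum.BoseEinsteinCondensation.Theorems.PeriodicIRBound.Negative
  (norm_intVec_le_sqrt_nsq sqrt_nsq_le_sqrt_three_mul_norm sqrt_nsq_pos)
open Summit.AtomisticToContinuum.BoseEinsteinCondensation.Cruxes.PeriodicIRBound.LinearPhFloorWagner
  (TransferArith.norm_latticeVec_eq)
open Summit.AtomisticToContinuum.BoseEinsteinCondensation.Cruxes.PeriodicIRBound.LinearPhFloorWagner.WF
  (wagnerFeynmanWith_two)

/-! ## §1 The per-mode bound: quadratic floor + Wagner–Feynman -/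

/-- **Per-mode occupation bound from the quadratic floor.** For an integrable admissible `v` with the
fixed-`(N, L)` zero-momentum gap, `N ≥ 2`, `E₀^per(N,L) < ∞`, and a dual-lattice momentum `p = 2πk/L`,
`k ≠ 0`, at which the particle–hole sector sum exceeds `2E₀^per(N,L)` by `2κ‖p‖²` (`κ > 0`), the
ground-state occupation obeys `γ_N(k) ≤ 1/κ + (N‖v‖₁/L³)/(κ‖p‖²)` — the landed Wagner–Feynman bound
`γ_N(k)·θ ≤ 2(‖p‖² + N‖v‖₁/L³)` (`wagnerFeynmanWith_two`) at `θ = 2κ‖p‖²`, divided by `θ`. [folklore] -/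
theorem groundOccupation_le_of_floor {v : ℝ → ℝ≥0∞} (hv : IsRepulsiveFiniteRange v)
    (hint : (∫⁻ x : Space, v ‖x‖) ≠ ⊤)
    (hgap : ∀ (N : ℕ) (L : ℝ), 0 < L → ∀ q : Space, q ≠ 0 →
      periodicGroundStateEnergy v N L < momentumSectorEnergy v N L q)
    {N : ℕ} {L : ℝ} (hN : 2 ≤ N) (hL : 0 < L) (hE : periodicGroundStateEnergy v N L ≠ ⊤)
    {κ : ℝ} (hκ : 0 < κ) {k : Fin 3 → ℤ} (hk : k ≠ 0)
    (hfloor : 2 * periodicGroundStateEnergy v N L +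
        ENNReal.ofReal (2 * κ * ‖latticeVec (2 * Real.pi / L) k‖ ^ 2) ≤
      momentumSectorEnergy v (N + 1) L (latticeVec (2 * Real.pi / L) k) +
        momentumSectorEnergy v (N - 1) L (latticeVec (2 * Real.pi / L) k)) :
    groundOccupation v N L k ≤ ENNReal.ofReal (1 / κ +
      (N * (∫⁻ x : Space, v ‖x‖).toReal / L ^ 3) / (κ * ‖latticeVec (2 * Real.pi / L) k‖ ^ 2)) := by
  have hV₁0 : 0 ≤ (∫⁻ x : Space, v ‖x‖).toReal := ENNReal.toReal_nonneg
  have hc : 0 < 2 * Real.pi / L := by positivity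
  have hPpos : 0 < ‖latticeVec (2 * Real.pi / L) k‖ := by
    rw [TransferArith.norm_latticeVec_eq, abs_of_pos hc]
    exact mul_pos hc (sqrt_nsq_pos hk)
  have ht : 0 < 2 * κ * ‖latticeVec (2 * Real.pi / L) k‖ ^ 2 := by positivity
  have hWF := wagnerFeynmanWith_two v hv hint hgap N L hN hL hE k hk _ ht.le hfloor
  have hγ : groundOccupation v N L k ≤
      ENNReal.ofReal (2 * (‖latticeVec (2 * Real.pi / L) k‖ ^ 2 +
        N * (∫⁻ x : Space, v ‖x‖).toReal / L ^ 3) / (2 * κ * ‖latticeVec (2 * Real.pi / L) k‖ ^ 2))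
            := by
    rw [ENNReal.ofReal_div_of_pos ht]
    exact (ENNReal.le_div_iff_mul_le (Or.inl (ENNReal.ofReal_pos.2 ht).ne')
      (Or.inl ENNReal.ofReal_ne_top)).2 hWF
  refine hγ.trans (le_of_eq (congrArg ENNReal.ofReal ?_))
  field_simp

/-- **Window arithmetic along a box with `ρL³ = N`.** With the quadratic floor of constant `κ` on the
momentum window `‖q‖² ≤ 12π²κ'²ρ`, every mode `0 < ‖k‖_∞ ≤ κ'√ρ L` has `p = 2πk/L` in the window
(`|k|₂ ≤ √3‖k‖_∞`) and `‖p‖ ≥ 2π‖k‖_∞/L`, whence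
`γ_N(k) ≤ 1/κ + (N‖v‖₁/L³)·L²/(4π²κ‖k‖_∞²)`. [folklore] -/
theorem groundOccupation_le_on_window {v : ℝ → ℝ≥0∞} (hv : IsRepulsiveFiniteRange v)
    (hint : (∫⁻ x : Space, v ‖x‖) ≠ ⊤)
    (hgap : ∀ (N : ℕ) (L : ℝ), 0 < L → ∀ q : Space, q ≠ 0 →
      periodicGroundStateEnergy v N L < momentumSectorEnergy v N L q)
    {N : ℕ} {L ρ κ κ' : ℝ} (hN : 2 ≤ N) (hL : 0 < L) (hρ : 0 < ρ)
    (hE : periodicGroundStateEnergy v N L ≠ ⊤) (hκ : 0 < κ)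
    (hfloor : ∀ q : Space, q ≠ 0 → ‖q‖ ^ 2 ≤ 12 * Real.pi ^ 2 * κ' ^ 2 * ρ →
      2 * periodicGroundStateEnergy v N L + ENNReal.ofReal (2 * κ * ‖q‖ ^ 2) ≤
        momentumSectorEnergy v (N + 1) L q + momentumSectorEnergy v (N - 1) L q)
    {k : Fin 3 → ℤ} (hk : k ≠ 0) (hkK : ‖(fun i : Fin 3 => ((k i : ℤ) : ℝ))‖ ≤ κ' * Real.sqrt ρ *
        L) :
    groundOccupation v N L k ≤ ENNReal.ofReal (1 / κ +
      (N * (∫⁻ x : Space, v ‖x‖).toReal / L ^ 3) * L ^ 2 / (4 * Real.pi ^ 2 * κ * ‖(fun i : Fin 3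
          => ((k i : ℤ) : ℝ))‖ ^ 2)) := by
  have hV₁0 : 0 ≤ (∫⁻ x : Space, v ‖x‖).toReal := ENNReal.toReal_nonneg
  have hn1 : 1 ≤ ‖(fun i : Fin 3 => ((k i : ℤ) : ℝ))‖ := one_le_norm_intVec hk
  have hn : 0 < ‖(fun i : Fin 3 => ((k i : ℤ) : ℝ))‖ := one_pos.trans_le hn1
  -- the dual-lattice momentum `p = (2π/L) k`
  have hc : 0 < 2 * Real.pi / L := by positivity
  have hP : ‖latticeVec (2 * Real.pi / L) k‖ = 2 * Real.pi / L * Real.sqrt (nsq k) := by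
    rw [TransferArith.norm_latticeVec_eq, abs_of_pos hc]
  have hPpos : 0 < ‖latticeVec (2 * Real.pi / L) k‖ := by
    rw [hP]
    exact mul_pos hc (sqrt_nsq_pos hk)
  have hp0 : latticeVec (2 * Real.pi / L) k ≠ 0 := norm_pos_iff.1 hPpos
  have hPle : ‖latticeVec (2 * Real.pi / L) k‖ ≤ 2 * Real.pi / L * (Real.sqrt 3 * ‖(fun i : Fin 3
      => ((k i : ℤ) : ℝ))‖) := by
    rw [hP]
    exact mul_le_mul_of_nonneg_left (sqrt_nsq_le_sqrt_three_mul_norm k) hc.le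
  have hPge : 2 * Real.pi / L * ‖(fun i : Fin 3 => ((k i : ℤ) : ℝ))‖ ≤ ‖latticeVec (2 * Real.pi /
      L) k‖ := by
    rw [hP]
    exact mul_le_mul_of_nonneg_left (norm_intVec_le_sqrt_nsq k) hc.le
  -- the window: `‖p‖ ≤ 2√3πκ'√ρ`, so `‖p‖² ≤ 12π²κ'²ρ`
  have hPκ : ‖latticeVec (2 * Real.pi / L) k‖ ≤ 2 * Real.sqrt 3 * Real.pi * κ' * Real.sqrt ρ := by
    calc ‖latticeVec (2 * Real.pi / L) k‖ ≤ 2 * Real.pi / L * (Real.sqrt 3 * ‖(fun i : Fin 3 => ((k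
        i : ℤ) : ℝ))‖) := hPle
      _ ≤ 2 * Real.pi / L * (Real.sqrt 3 * (κ' * Real.sqrt ρ * L)) := by gcongr
      _ = 2 * Real.sqrt 3 * Real.pi * κ' * Real.sqrt ρ := by
          rw [div_mul_eq_mul_div, div_eq_iff hL.ne']
          ring
  have hP2 : ‖latticeVec (2 * Real.pi / L) k‖ ^ 2 ≤ 12 * Real.pi ^ 2 * κ' ^ 2 * ρ := by
    have h3 : Real.sqrt 3 ^ 2 = 3 := Real.sq_sqrt (by norm_num)
    have hρ2 : Real.sqrt ρ ^ 2 = ρ := Real.sq_sqrt hρ.le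
    calc ‖latticeVec (2 * Real.pi / L) k‖ ^ 2 ≤ (2 * Real.sqrt 3 * Real.pi * κ' * Real.sqrt ρ) ^ 2
        :=
          pow_le_pow_left₀ (norm_nonneg _) hPκ 2
      _ = 4 * Real.sqrt 3 ^ 2 * Real.pi ^ 2 * κ' ^ 2 * Real.sqrt ρ ^ 2 := by ring
      _ = 12 * Real.pi ^ 2 * κ' ^ 2 * ρ := by
          rw [h3, hρ2]
          ring
  -- the floor at `p`, fed into the Wagner–Feynman bound
  have hγ := groundOccupation_le_of_floor hv hint hgap hN hL hE hκ hk (hfloor _ hp0 hP2)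
  refine hγ.trans (ENNReal.ofReal_le_ofReal (add_le_add le_rfl ?_))
  -- `X/(κ‖p‖²) ≤ X L²/(4π²κ ν²)` from `‖p‖ ≥ 2π ν/L`
  have hden : 4 * Real.pi ^ 2 * κ * ‖(fun i : Fin 3 => ((k i : ℤ) : ℝ))‖ ^ 2 ≤ κ * ‖latticeVec (2 *
      Real.pi / L) k‖ ^ 2 * L ^ 2 := by
    have h1 : (2 * Real.pi / L * ‖(fun i : Fin 3 => ((k i : ℤ) : ℝ))‖) ^ 2 ≤ ‖latticeVec (2 *
        Real.pi / L) k‖ ^ 2 :=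
      pow_le_pow_left₀ (by positivity) hPge 2
    have h3 := mul_le_mul_of_nonneg_left h1 (by positivity : (0 : ℝ) ≤ κ * L ^ 2)
    calc 4 * Real.pi ^ 2 * κ * ‖(fun i : Fin 3 => ((k i : ℤ) : ℝ))‖ ^ 2 = κ * L ^ 2 * (2 * Real.pi
        / L * ‖(fun i : Fin 3 => ((k i : ℤ) : ℝ))‖) ^ 2 := by
          field_simp
          ring
      _ ≤ κ * L ^ 2 * ‖latticeVec (2 * Real.pi / L) k‖ ^ 2 := h3
      _ = κ * ‖latticeVec (2 * Real.pi / L) k‖ ^ 2 * L ^ 2 := by ring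
  rw [div_le_div_iff₀ (by positivity) (by positivity)]
  calc N * (∫⁻ x : Space, v ‖x‖).toReal / L ^ 3 * (4 * Real.pi ^ 2 * κ * ‖(fun i : Fin 3 => ((k i :
      ℤ) : ℝ))‖ ^ 2)
      ≤ N * (∫⁻ x : Space, v ‖x‖).toReal / L ^ 3 * (κ * ‖latticeVec (2 * Real.pi / L) k‖ ^ 2 * L ^
          2) :=
        mul_le_mul_of_nonneg_left hden (by positivity)
    _ = N * (∫⁻ x : Space, v ‖x‖).toReal / L ^ 3 * L ^ 2 *
        (κ * ‖latticeVec (2 * Real.pi / L) k‖ ^ 2) := by ring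

end Summit.AtomisticToContinuum.BoseEinsteinCondensation.Theorems.MomentBoundCondensation

/-! ## §2 The route item -/

namespace Summit.AtomisticToContinuum.BoseEinsteinCondensation.Theorems

open Literature.MathematicalPhysics.QuantumManyBody.BoseGas
open Summit.AtomisticToContinuum.BoseEinsteinCondensation.Theorems.PeriodicIRBound.Negative
  (groundOccupation)
open Summit.AtomisticToContinuum.BoseEinsteinCondensation.Theorems.GaussianDominationCan.Negative
  (one_le_norm_intVec)
open Summit.AtomisticToContinuum.BoseEinsteinCondensation.Theorems.ModeCounting
open Summit.AtomisticToContinuum.BoseEinsteinCondensation.Theorems.MomentBoundCondensation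

/-- **Moment bound ⇒ condensation** (route BECFeynmanVortexArea / BECNoCheapMomentum, item
`MomentBoundCondensation`, stmt-AtomisticToContinuum-11846): for an integrable repulsive finite-range
`v` (the hypothesis `∫v ≠ 0` is not needed), the fixed-`(N,L)` zero-momentum gap and the quadratic
particle–hole sector floor on the windows `‖k‖² ≤ Cρ` imply, for all small `ρ`, condensation
`⟨Ψ, n₀Ψ⟩ ≥ N/2` of the `δ_N`-near-minimisers on the torus of side `L_N = (N/ρ)^{1/3}`, eventually in
`N`. Constants: UV window `κ'² = (A+1)/π²`, `A = 4πa(1 + C₁c₁)` (LSSY Thm. 2.2, tail `≤ N/4` by the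
kinetic Markov bound with slack `δ_N ≤ ρN`); floor taken at `C = 12π²κ'²` giving `κ`; per-mode bound
`n_k ≤ 2/κ + ρ‖v‖₁L²/(2π²κ‖k‖_∞²)` on `0 < ‖k‖_∞ ≤ κ'√ρL_N` (Wagner–Feynman, `wagnerFeynmanWith_two`);
window sum `≤ √ρN(52κ'³ + 13κ'‖v‖₁/π²)/κ ≤ N/4` for `√ρ` small. [folklore] -/
theorem momentBoundCondensation_proof :
    Summit.AtomisticToContinuum.BoseEinsteinCondensation.Theses.BECFeynmanVortexArea.MomentBoundCondensation := by
  intro v hv hint _hne0 hZ hS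
  -- the zero-momentum gap in the tree's vocabulary (definitional)
  have hgap : ∀ (N : ℕ) (L : ℝ), 0 < L → ∀ q : Space, q ≠ 0 →
      periodicGroundStateEnergy v N L < momentumSectorEnergy v N L q :=
    fun N L hL q hq => hZ N L hL q hq
  -- constants attached to `v`: range, scattering length, the LSSY upper bound, `‖v‖₁`
  obtain ⟨R, hR, hvR⟩ := hv.exists_pos_range
  obtain ⟨C₁, c₁, hC₁, hc₁, hLSSY⟩ :=
    LSSY2005_upperBound_periodic_holds v R hv.1 hvR hv.scatteringLength_ne_top
  set a : ℝ := (scatteringLength v).toReal with ha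
  have ha0 : 0 ≤ a := ENNReal.toReal_nonneg
  set A : ℝ := 4 * Real.pi * a * (1 + C₁ * c₁) with hA
  have hA0 : 0 ≤ A := by positivity
  set κ' : ℝ := Real.sqrt (A + 1) / Real.pi with hκ'
  have hκ'0 : 0 < κ' := by positivity
  have hκ'2 : Real.pi ^ 2 * κ' ^ 2 = A + 1 := by
    rw [hκ', div_pow, Real.sq_sqrt (by positivity)]
    field_simp
  set V₁ : ℝ := (∫⁻ x : Space, v ‖x‖).toReal with hV₁
  have hV₁0 : 0 ≤ V₁ := ENNReal.toReal_nonneg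
  -- the quadratic floor on the window `‖p‖² ≤ 12π²κ'²ρ`
  obtain ⟨κ, hκ, ρS, hρS, HS⟩ := hS (12 * Real.pi ^ 2 * κ' ^ 2) (by positivity)
  -- density thresholds
  set ρa : ℝ := 3 * (c₁ / (a + 1)) ^ 3 / (4 * Real.pi) with hρa
  have hρa0 : 0 < ρa := by positivity
  set Q : ℝ := 4 * (52 * κ' ^ 3 + 13 * κ' * V₁ / Real.pi ^ 2) / κ with hQ
  have hQ0 : 0 < Q := by positivity
  set ρW : ℝ := (1 / (Q + 1)) ^ 2 with hρW
  have hρW0 : 0 < ρW := by positivity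
  refine ⟨min ρS (min ρa ρW), lt_min hρS (lt_min hρa0 hρW0), fun ρ hρ hρ₀ => ?_⟩
  have hρS' : ρ < ρS := lt_of_lt_of_le hρ₀ (min_le_left _ _)
  have hρa' : ρ < ρa := lt_of_lt_of_le hρ₀ ((min_le_right _ _).trans (min_le_left _ _))
  have hρW' : ρ < ρW := lt_of_lt_of_le hρ₀ ((min_le_right _ _).trans (min_le_right _ _))
  -- consequences of the thresholds
  have hsmall : (a + 1) * (4 * Real.pi * ρ / 3) ^ ((1 : ℝ) / 3) < c₁ := by
    have h1 : 4 * Real.pi * ρ / 3 < (c₁ / (a + 1)) ^ 3 := by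
      rw [hρa, lt_div_iff₀ (by positivity)] at hρa'
      rw [div_lt_iff₀ (by norm_num : (0 : ℝ) < 3)]
      linarith
    have h2 : (4 * Real.pi * ρ / 3) ^ ((1 : ℝ) / 3) < c₁ / (a + 1) := by
      calc (4 * Real.pi * ρ / 3) ^ ((1 : ℝ) / 3) < ((c₁ / (a + 1)) ^ 3) ^ ((1 : ℝ) / 3) :=
            Real.rpow_lt_rpow (by positivity) h1 (by norm_num)
        _ = c₁ / (a + 1) := by
            rw [show ((1 : ℝ) / 3) = ((3 : ℕ) : ℝ)⁻¹ by norm_num,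
              Real.pow_rpow_inv_natCast (by positivity) (by norm_num)]
    calc (a + 1) * (4 * Real.pi * ρ / 3) ^ ((1 : ℝ) / 3) < (a + 1) * (c₁ / (a + 1)) := by
          gcongr
      _ = c₁ := by field_simp
  have hsqrtρ : Q * Real.sqrt ρ ≤ 1 := by
    have h1 : Real.sqrt ρ < 1 / (Q + 1) := by
      calc Real.sqrt ρ < Real.sqrt ρW := Real.sqrt_lt_sqrt hρ.le hρW'
        _ = 1 / (Q + 1) := by rw [hρW, Real.sqrt_sq (by positivity)]
    rw [lt_div_iff₀ (by positivity)] at h1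
    nlinarith [Real.sqrt_nonneg ρ]
  -- the answer: `c = 1/2`, eventually in `N`
  refine ⟨1 / 2, by norm_num, ?_⟩
  filter_upwards [HS ρ hρ hρS', eventually_ge_atTop 2,
    (tendsto_sideLength_atTop hρ).eventually_gt_atTop (2 * R)] with N hSN hN2 hRL
  have hN : 0 < N := lt_of_lt_of_le two_pos hN2
  have hNr : (0 : ℝ) < N := Nat.cast_pos.2 hN
  -- the energy bound `E₀^per ≤ A ρ N` (LSSY Thm. 2.2), before abbreviating `L`
  have hE0 : periodicGroundStateEnergy v N (sideLength ρ N) ≤ ENNReal.ofReal (A * ρ * N) :=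
    periodicGroundStateEnergy_le_lssy hC₁ hLSSY hρ hsmall hN2 hRL
  set L : ℝ := sideLength ρ N with hLdef
  have hL : 0 < L := Real.rpow_pos_of_pos (div_pos hNr hρ) _
  have hL3 : ρ * L ^ 3 = N := by
    rw [hLdef, Literature.MathematicalPhysics.QuantumManyBody.BoseGas.sideLength_pow_three hρ N]
    field_simp
  have hNL : (N : ℝ) * V₁ / L ^ 3 = ρ * V₁ := by
    rw [← hL3]
    field_simp
  have hEtop : periodicGroundStateEnergy v N L ≠ ⊤ := ne_top_of_le_ne_top ENNReal.ofReal_ne_top hE0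
  -- the floor in the tree's vocabulary (definitional)
  have hfloor : ∀ q : Space, q ≠ 0 → ‖q‖ ^ 2 ≤ 12 * Real.pi ^ 2 * κ' ^ 2 * ρ →
      2 * periodicGroundStateEnergy v N L + ENNReal.ofReal (2 * κ * ‖q‖ ^ 2) ≤
        momentumSectorEnergy v (N + 1) L q + momentumSectorEnergy v (N - 1) L q :=
    fun q hq hqC => hSN q hq hqC
  -- the window `K = κ'√ρ L` and the per-mode profile `b_k = 1/κ + ρV₁L²/(4π²κ‖k‖_∞²)`
  set K : ℝ := κ' * Real.sqrt ρ * L with hK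
  have hK0 : 0 ≤ K := by positivity
  set b : (Fin 3 → ℤ) → ℝ := fun k =>
    1 / κ + ρ * V₁ * L ^ 2 / (4 * Real.pi ^ 2 * κ * ‖(fun i : Fin 3 => ((k i : ℤ) : ℝ))‖ ^ 2)
    with hb
  have hbpos : ∀ k, 0 < b k := fun k => by
    have h1 : 0 < 1 / κ := by positivity
    have h2 : 0 ≤ ρ * V₁ * L ^ 2 / (4 * Real.pi ^ 2 * κ * ‖(fun i : Fin 3 => ((k i : ℤ) : ℝ))‖ ^ 2)
        :=
      by positivity
    simp only [hb]
    linarith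
  -- per-mode bound on the window from the floor and the Wagner–Feynman bound
  have hmode : ∀ k : Fin 3 → ℤ, k ≠ 0 → ‖(fun i : Fin 3 => ((k i : ℤ) : ℝ))‖ ≤ K →
      groundOccupation v N L k ≤ ENNReal.ofReal (b k) := by
    intro k hk hkK
    have h := groundOccupation_le_on_window hv hint hgap hN2 hL hρ hEtop hκ hfloor hk hkK
    rw [hNL] at h
    simpa only [hb] using h
  -- the least slack over the finite box containing the window
  set M : ℕ := ⌊K⌋₊ with hM
  set W : Finset (Fin 3 → ℤ) := (Fintype.piFinset fun _ : Fin 3 =>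
      Finset.Icc (-((M : ℕ) : ℤ)) ((M : ℕ) : ℤ)).erase 0 with hW
  have hslack : ∃ δ : ℝ≥0∞, 0 < δ ∧ ∀ Ψ : PeriodicTrialState N L,
      periodicEnergy v Ψ ≤ periodicGroundStateEnergy v N L + δ →
        ∀ k ∈ W, cellOccupation N L (planeWaveMode L k) Ψ.ψ ≤ ENNReal.ofReal (2 * b k) := by
    by_cases hWne : W.Nonempty
    · refine exists_slack_of_groundOccupation_le W hWne b (fun k _ => hbpos k) fun k hkW => ?_
      rw [hW, Finset.mem_erase] at hkW
      have hkM : ∀ j, |k j| ≤ (M : ℤ) := mem_latticeBox.1 hkW.2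
      refine hmode k hkW.1 ?_
      -- `‖k‖_∞ ≤ M ≤ K`
      have h1 : ‖(fun i : Fin 3 => ((k i : ℤ) : ℝ))‖ ≤ (M : ℝ) := by
        refine (pi_norm_le_iff_of_nonneg (by positivity)).2 fun j => ?_
        rw [Real.norm_eq_abs, ← Int.cast_abs]
        exact_mod_cast hkM j
      exact h1.trans (Nat.floor_le hK0)
    · exact ⟨1, one_pos, fun Ψ _ k hk => (hWne ⟨k, hk⟩).elim⟩
  obtain ⟨δW, hδW, hWΨ⟩ := hslack
  refine ⟨min δW (ENNReal.ofReal (ρ * N)), lt_min hδW (ENNReal.ofReal_pos.2 (by positivity)), ?_⟩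
  intro Ψ hΨ
  have hΨW : periodicEnergy v Ψ ≤ periodicGroundStateEnergy v N L + δW :=
    hΨ.trans (add_le_add le_rfl (min_le_left _ _))
  have hΨE : periodicEnergy v Ψ ≤ ENNReal.ofReal ((A + 1) * ρ * N) := by
    calc periodicEnergy v Ψ ≤ periodicGroundStateEnergy v N L + ENNReal.ofReal (ρ * N) :=
          hΨ.trans (add_le_add le_rfl (min_le_right _ _))
      _ ≤ ENNReal.ofReal (A * ρ * N) + ENNReal.ofReal (ρ * N) := add_le_add hE0 le_rfl
      _ = ENNReal.ofReal ((A + 1) * ρ * N) := by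
          rw [← ENNReal.ofReal_add (by positivity) (by positivity)]
          exact congrArg ENNReal.ofReal (by ring)
  -- the counting step with `K = κ'√ρL`, `B₁ = 2/κ`, `B₂ = ρV₁L²/(2π²κ)`, `D = 4π²κ'²ρ`
  set D : ℝ≥0∞ := ENNReal.ofReal (4 * Real.pi ^ 2 * κ' ^ 2 * ρ) with hD
  have hDpos : 0 < 4 * Real.pi ^ 2 * κ' ^ 2 * ρ := by positivity
  have hD0 : D ≠ 0 := (ENNReal.ofReal_pos.2 hDpos).ne'
  refine condensate_ge_half_of_sq hL hK0 (B₁ := 2 / κ) (B₂ := ρ * V₁ * L ^ 2 / (2 * Real.pi ^ 2 *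
      κ))
    (by positivity) (by positivity) v Ψ hD0 ENNReal.ofReal_ne_top ?_ ?_ ?_ ?_
  · -- (IR) the per-mode bounds at the common slack
    intro k hk0 hkK
    have hkW : k ∈ W := by
      rw [hW, Finset.mem_erase]
      exact ⟨hk0, mem_latticeBox_floor_of_norm_le hkK⟩
    refine (hWΨ Ψ hΨW k hkW).trans (le_of_eq (congrArg ENNReal.ofReal ?_))
    simp only [hb]
    have hn : 0 < ‖(fun i : Fin 3 => ((k i : ℤ) : ℝ))‖ := one_pos.trans_le (one_le_norm_intVec hk0)
    field_simp
    ring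
  · -- (UV) `4π²κ'²ρ ≤ |2πk/L|²` off the window (`‖k‖_∞² ≤ |k|₂²`)
    intro k hk
    rw [hD, fracDispersion_two]
    refine ENNReal.ofReal_le_ofReal ?_
    have h1 : (κ' * Real.sqrt ρ * L) ^ 2 < ∑ j, (k j : ℝ) ^ 2 := by
      calc (κ' * Real.sqrt ρ * L) ^ 2 < ‖(fun i => (k i : ℝ))‖ ^ 2 := by gcongr
        _ ≤ ∑ j, (k j : ℝ) ^ 2 := norm_sq_le_sum_sq k
    rw [mul_pow, mul_pow, Real.sq_sqrt hρ.le] at h1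
    rw [le_div_iff₀ (by positivity)]
    calc 4 * Real.pi ^ 2 * κ' ^ 2 * ρ * L ^ 2 = 4 * Real.pi ^ 2 * (κ' ^ 2 * ρ * L ^ 2) := by ring
      _ ≤ 4 * Real.pi ^ 2 * ∑ j, (k j : ℝ) ^ 2 := by gcongr
  · -- (T) `(E₀ + δ)/(4π²κ'²ρ) ≤ (A+1)ρN/(4(A+1)ρ) = N/4`
    calc D⁻¹ * periodicEnergy v Ψ ≤ D⁻¹ * ENNReal.ofReal ((A + 1) * ρ * N) := by gcongr
      _ = ENNReal.ofReal ((A + 1) * ρ * N / (4 * Real.pi ^ 2 * κ' ^ 2 * ρ)) := by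
          rw [← ENNReal.div_eq_inv_mul, hD, ← ENNReal.ofReal_div_of_pos hDpos]
      _ = ENNReal.ofReal (N / 4) := by
          congr 1
          rw [show 4 * Real.pi ^ 2 * κ' ^ 2 * ρ = 4 * (Real.pi ^ 2 * κ' ^ 2) * ρ by ring, hκ'2]
          field_simp
  · -- (window) `(2/κ)·26K³ + (ρV₁L²/(2π²κ))·26K = √ρ N (52κ'³ + 13κ'V₁/π²)/κ ≤ N/4`
    have hs0 : 0 < Real.sqrt ρ := Real.sqrt_pos.2 hρ
    have key : ∀ s : ℝ, 0 < s →
        2 / κ * (26 * (κ' * s * L) ^ 3) + s ^ 2 * V₁ * L ^ 2 / (2 * Real.pi ^ 2 * κ) *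
            (26 * (κ' * s * L)) =
          4 * (52 * κ' ^ 3 + 13 * κ' * V₁ / Real.pi ^ 2) / κ * s * (s ^ 2 * L ^ 3) / 4 := by
      intro s hs
      field_simp
      ring
    have h1 : 2 / κ * (26 * K ^ 3) + ρ * V₁ * L ^ 2 / (2 * Real.pi ^ 2 * κ) * (26 * K) =
        Q * Real.sqrt ρ * (ρ * L ^ 3) / 4 := by
      have h := key (Real.sqrt ρ) hs0
      rw [Real.sq_sqrt hρ.le] at h
      rw [hK, hQ]
      exact h
    rw [h1, hL3]
    have h2 : Q * Real.sqrt ρ * N ≤ N := by nlinarith [hsqrtρ, hNr.le]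
    linarith

/-- The same item as filed verbatim in route `BECNoCheapMomentum` (stmt-AtomisticToContinuum-11846 is
wanted by both routes with syntactically identical bodies): proved by the same term. -/
theorem momentBoundCondensation_proof' :
    Summit.AtomisticToContinuum.BoseEinsteinCondensation.Theses.BECNoCheapMomentum.MomentBoundCondensation :=
  momentBoundCondensation_proof

end Summit.AtomisticToContinuum.BoseEinsteinCondensation.Theorems

end
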